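import Summits.AnomalousDissipation.AnomalousDissipation.Theorems.MarginalStabilityChainStrainedLayerLawStubVorticityUniformBoundsC
import Mathlib.Analysis.SpecialFunctions.SmoothTransition

/-!
# Stub `stub_vorticityUniformBounds` (crux stmt-AnomalousDissipation-3007, line `strain-work-sum-rule`) — tools F:
# space–time calculus of the vorticity; the cutoff across the layer

Support file (`--supports stmt-AnomalousDissipation-3007`; registered sub-goal `stub_vorticityUniformBounds_vorticityTime`).
For velocity fields `u, v` jointly `C²` on `(0, ∞) × ℝ²`: the directional first and second space–time derivatives along
the coordinate lines, their continuity on the domain, the SYMMETRY of the second derivatives (Mathlib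
`ContDiffAt.isSymmSndFDerivAt`), whence `∂ₜω = ∂ₓ(∂ₜv) − ∂_y(∂ₜu)` for `ω(t) = ∂ₓv(t) − ∂_yu(t)`
(`stub_vorticityUniformBounds_vorticityTime`), the joint continuity of `ω` and `∂ₜω`, and the `C¹`-regularity and
`x`-periodicity of the time-derivative slices. Second part: the cutoff `ψ_R(y) = σ(2 − y/R)σ(2 + y/R)`
(`σ` = Mathlib's `Real.smoothTransition`): `C¹`, `0 ≤ ψ_R ≤ 1`, `= 1` for `|y| ≤ R`, `= 0` for `|y| ≥ 2R`,
`ψ_R′ = 0` off `R ≤ |y| ≤ 2R`, `|ψ_R′| ≤ 2C_σ/R`. All `[folklore]`.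
-/

-- `Summit.<Summit>.<Problem>` is the tree's mandated summit-side namespace (CONVENTIONS §2); for this
-- single-conjunct summit the two coincide, so the duplicate is deliberate.
set_option linter.dupNamespace false

noncomputable section

open scoped Topology ENNReal
open Filter Set Function MeasureTheory

namespace Summit.AnomalousDissipation.AnomalousDissipation.Theorems.StrainedLayerLaw.StrainWorkSumRule

open Literature.Analysis.FluidPDE Literature.Analysis.FluidPDE.StretchedLayer
open Summit.AnomalousDissipation.AnomalousDissipation.Theorems.MarginalStabilityChainStretchedVortexRows

/-! ## Space–time calculus of a field `C²` on `(0, ∞) × ℝ²` -/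

section SpaceTime

variable {w : ℝ → ℝ → ℝ → ℝ}

/-- The space–time domain `(0, ∞) × ℝ²` is open. [folklore] -/
theorem kato_isOpen_spacetime : IsOpen ((Ioi (0:ℝ)) ×ˢ (univ : Set (ℝ × ℝ))) := isOpen_Ioi.prod isOpen_univ

/-- A field `C²` on the open space–time domain is differentiable at its points. [folklore] -/
theorem kato_differentiableAt_spacetime
    (hw : ContDiffOn ℝ 2 (fun q : ℝ × ℝ × ℝ => w q.1 q.2.1 q.2.2) (Ioi 0 ×ˢ univ)) {t : ℝ} (ht : 0 < t)
    (x y : ℝ) : DifferentiableAt ℝ (fun q : ℝ × ℝ × ℝ => w q.1 q.2.1 q.2.2) (t, x, y) := by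
  have hq : ((t, x, y) : ℝ × ℝ × ℝ) ∈ Ioi (0:ℝ) ×ˢ (univ : Set (ℝ × ℝ)) := ⟨ht, mem_univ _⟩
  exact (hw.differentiableOn two_ne_zero _ hq).differentiableAt (kato_isOpen_spacetime.mem_nhds hq)

/-- Time lines: `∂ₜw(t, x, y) = Dw(t,x,y)(1,0,0)` (`t > 0`). [folklore] -/
theorem kato_hasDerivAt_time_fderiv
    (hw : ContDiffOn ℝ 2 (fun q : ℝ × ℝ × ℝ => w q.1 q.2.1 q.2.2) (Ioi 0 ×ˢ univ)) {t : ℝ} (ht : 0 < t)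
    (x y : ℝ) : HasDerivAt (fun s => w s x y)
      (fderiv ℝ (fun q : ℝ × ℝ × ℝ => w q.1 q.2.1 q.2.2) (t, x, y) (1, 0, 0)) t := by
  have h1 : HasDerivAt (fun s : ℝ => ((s, x, y) : ℝ × ℝ × ℝ)) ((1:ℝ), (0:ℝ), (0:ℝ)) t :=
    (hasDerivAt_id t).prodMk ((hasDerivAt_const t x).prodMk (hasDerivAt_const t y))
  exact (kato_differentiableAt_spacetime hw ht x y).hasFDerivAt.comp_hasDerivAt t h1

/-- `x`-lines: `∂ₓw(t, x, y) = Dw(t,x,y)(0,1,0)` (`t > 0`). [folklore] -/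
theorem kato_hasDerivAt_x_fderiv
    (hw : ContDiffOn ℝ 2 (fun q : ℝ × ℝ × ℝ => w q.1 q.2.1 q.2.2) (Ioi 0 ×ˢ univ)) {t : ℝ} (ht : 0 < t)
    (x y : ℝ) : HasDerivAt (fun s => w t s y)
      (fderiv ℝ (fun q : ℝ × ℝ × ℝ => w q.1 q.2.1 q.2.2) (t, x, y) (0, 1, 0)) x := by
  have h1 : HasDerivAt (fun s : ℝ => ((t, s, y) : ℝ × ℝ × ℝ)) ((0:ℝ), (1:ℝ), (0:ℝ)) x :=
    (hasDerivAt_const x t).prodMk ((hasDerivAt_id x).prodMk (hasDerivAt_const x y))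
  exact (kato_differentiableAt_spacetime hw ht x y).hasFDerivAt.comp_hasDerivAt x h1

/-- `y`-lines: `∂_yw(t, x, y) = Dw(t,x,y)(0,0,1)` (`t > 0`). [folklore] -/
theorem kato_hasDerivAt_y_fderiv
    (hw : ContDiffOn ℝ 2 (fun q : ℝ × ℝ × ℝ => w q.1 q.2.1 q.2.2) (Ioi 0 ×ˢ univ)) {t : ℝ} (ht : 0 < t)
    (x y : ℝ) : HasDerivAt (fun s => w t x s)
      (fderiv ℝ (fun q : ℝ × ℝ × ℝ => w q.1 q.2.1 q.2.2) (t, x, y) (0, 0, 1)) y := by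
  have h1 : HasDerivAt (fun s : ℝ => ((t, x, s) : ℝ × ℝ × ℝ)) ((0:ℝ), (0:ℝ), (1:ℝ)) y :=
    (hasDerivAt_const y t).prodMk ((hasDerivAt_const y x).prodMk (hasDerivAt_id y))
  exact (kato_differentiableAt_spacetime hw ht x y).hasFDerivAt.comp_hasDerivAt y h1

/-- The directional first derivatives `q ↦ Dw(q)e` are `C¹` on the space–time domain. [folklore] -/
theorem kato_contDiffOn_fderiv_apply
    (hw : ContDiffOn ℝ 2 (fun q : ℝ × ℝ × ℝ => w q.1 q.2.1 q.2.2) (Ioi 0 ×ˢ univ)) (e : ℝ × ℝ × ℝ) :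
    ContDiffOn ℝ 1 (fun q => fderiv ℝ (fun q : ℝ × ℝ × ℝ => w q.1 q.2.1 q.2.2) q e) (Ioi 0 ×ˢ univ) :=
  (hw.fderiv_of_isOpen kato_isOpen_spacetime (by norm_num)).clm_apply contDiffOn_const

/-- … hence continuous there. [folklore] -/
theorem kato_continuousOn_fderiv_apply
    (hw : ContDiffOn ℝ 2 (fun q : ℝ × ℝ × ℝ => w q.1 q.2.1 q.2.2) (Ioi 0 ×ˢ univ)) (e : ℝ × ℝ × ℝ) :
    ContinuousOn (fun q => fderiv ℝ (fun q : ℝ × ℝ × ℝ => w q.1 q.2.1 q.2.2) q e) (Ioi 0 ×ˢ univ) :=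
  (kato_contDiffOn_fderiv_apply hw e).continuousOn

/-- … and differentiable at its points. [folklore] -/
theorem kato_differentiableAt_fderiv_apply
    (hw : ContDiffOn ℝ 2 (fun q : ℝ × ℝ × ℝ => w q.1 q.2.1 q.2.2) (Ioi 0 ×ˢ univ)) (e : ℝ × ℝ × ℝ)
    {t : ℝ} (ht : 0 < t) (x y : ℝ) :
    DifferentiableAt ℝ (fun q => fderiv ℝ (fun q : ℝ × ℝ × ℝ => w q.1 q.2.1 q.2.2) q e) (t, x, y) := by
  have hq : ((t, x, y) : ℝ × ℝ × ℝ) ∈ Ioi (0:ℝ) ×ˢ (univ : Set (ℝ × ℝ)) := ⟨ht, mem_univ _⟩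
  exact ((kato_contDiffOn_fderiv_apply hw e).differentiableOn one_ne_zero _ hq).differentiableAt
    (kato_isOpen_spacetime.mem_nhds hq)

/-- Second derivatives along time lines of the directional first derivatives. [folklore] -/
theorem kato_hasDerivAt_time_fderiv2
    (hw : ContDiffOn ℝ 2 (fun q : ℝ × ℝ × ℝ => w q.1 q.2.1 q.2.2) (Ioi 0 ×ˢ univ)) (e : ℝ × ℝ × ℝ)
    {t : ℝ} (ht : 0 < t) (x y : ℝ) :
    HasDerivAt (fun s => fderiv ℝ (fun q : ℝ × ℝ × ℝ => w q.1 q.2.1 q.2.2) (s, x, y) e)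
      (fderiv ℝ (fun r => fderiv ℝ (fun q : ℝ × ℝ × ℝ => w q.1 q.2.1 q.2.2) r e) (t, x, y) (1, 0, 0)) t := by
  have h1 : HasDerivAt (fun s : ℝ => ((s, x, y) : ℝ × ℝ × ℝ)) ((1:ℝ), (0:ℝ), (0:ℝ)) t :=
    (hasDerivAt_id t).prodMk ((hasDerivAt_const t x).prodMk (hasDerivAt_const t y))
  exact (kato_differentiableAt_fderiv_apply hw e ht x y).hasFDerivAt.comp_hasDerivAt t h1

/-- Second derivatives along `x`-lines of the directional first derivatives. [folklore] -/
theorem kato_hasDerivAt_x_fderiv2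
    (hw : ContDiffOn ℝ 2 (fun q : ℝ × ℝ × ℝ => w q.1 q.2.1 q.2.2) (Ioi 0 ×ˢ univ)) (e : ℝ × ℝ × ℝ)
    {t : ℝ} (ht : 0 < t) (x y : ℝ) :
    HasDerivAt (fun s => fderiv ℝ (fun q : ℝ × ℝ × ℝ => w q.1 q.2.1 q.2.2) (t, s, y) e)
      (fderiv ℝ (fun r => fderiv ℝ (fun q : ℝ × ℝ × ℝ => w q.1 q.2.1 q.2.2) r e) (t, x, y) (0, 1, 0)) x := by
  have h1 : HasDerivAt (fun s : ℝ => ((t, s, y) : ℝ × ℝ × ℝ)) ((0:ℝ), (1:ℝ), (0:ℝ)) x :=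
    (hasDerivAt_const x t).prodMk ((hasDerivAt_id x).prodMk (hasDerivAt_const x y))
  exact (kato_differentiableAt_fderiv_apply hw e ht x y).hasFDerivAt.comp_hasDerivAt x h1

/-- Second derivatives along `y`-lines of the directional first derivatives. [folklore] -/
theorem kato_hasDerivAt_y_fderiv2
    (hw : ContDiffOn ℝ 2 (fun q : ℝ × ℝ × ℝ => w q.1 q.2.1 q.2.2) (Ioi 0 ×ˢ univ)) (e : ℝ × ℝ × ℝ)
    {t : ℝ} (ht : 0 < t) (x y : ℝ) :
    HasDerivAt (fun s => fderiv ℝ (fun q : ℝ × ℝ × ℝ => w q.1 q.2.1 q.2.2) (t, x, s) e)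
      (fderiv ℝ (fun r => fderiv ℝ (fun q : ℝ × ℝ × ℝ => w q.1 q.2.1 q.2.2) r e) (t, x, y) (0, 0, 1)) y := by
  have h1 : HasDerivAt (fun s : ℝ => ((t, x, s) : ℝ × ℝ × ℝ)) ((0:ℝ), (0:ℝ), (1:ℝ)) y :=
    (hasDerivAt_const y t).prodMk ((hasDerivAt_const y x).prodMk (hasDerivAt_id y))
  exact (kato_differentiableAt_fderiv_apply hw e ht x y).hasFDerivAt.comp_hasDerivAt y h1

/-- **Symmetry of the second space–time derivatives** (Schwarz, Mathlib `ContDiffAt.isSymmSndFDerivAt`).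
[folklore] -/
theorem kato_fderiv2_symm
    (hw : ContDiffOn ℝ 2 (fun q : ℝ × ℝ × ℝ => w q.1 q.2.1 q.2.2) (Ioi 0 ×ˢ univ)) {t : ℝ} (ht : 0 < t)
    (x y : ℝ) (e e' : ℝ × ℝ × ℝ) :
    fderiv ℝ (fun r => fderiv ℝ (fun q : ℝ × ℝ × ℝ => w q.1 q.2.1 q.2.2) r e) (t, x, y) e' =
      fderiv ℝ (fun r => fderiv ℝ (fun q : ℝ × ℝ × ℝ => w q.1 q.2.1 q.2.2) r e') (t, x, y) e := by
  set W : ℝ × ℝ × ℝ → ℝ := fun q => w q.1 q.2.1 q.2.2 with hW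
  have hq : ((t, x, y) : ℝ × ℝ × ℝ) ∈ Ioi (0:ℝ) ×ˢ (univ : Set (ℝ × ℝ)) := ⟨ht, mem_univ _⟩
  have hD : ContDiffOn ℝ 1 (fderiv ℝ W) (Ioi 0 ×ˢ univ) := hw.fderiv_of_isOpen kato_isOpen_spacetime (by norm_num)
  have hd : DifferentiableAt ℝ (fderiv ℝ W) (t, x, y) :=
    (hD.differentiableOn one_ne_zero _ hq).differentiableAt (kato_isOpen_spacetime.mem_nhds hq)
  rw [fderiv_clm_apply hd (differentiableAt_const _), fderiv_clm_apply hd (differentiableAt_const _)]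
  simp only [fderiv_fun_const, Pi.zero_apply, ContinuousLinearMap.comp_zero, zero_add,
    ContinuousLinearMap.flip_apply]
  exact ((hw.contDiffAt (kato_isOpen_spacetime.mem_nhds hq)).isSymmSndFDerivAt (by simp)).eq e' e

/-- The second space–time derivatives are continuous on the domain. [folklore] -/
theorem kato_continuousOn_fderiv2
    (hw : ContDiffOn ℝ 2 (fun q : ℝ × ℝ × ℝ => w q.1 q.2.1 q.2.2) (Ioi 0 ×ˢ univ)) (e e' : ℝ × ℝ × ℝ) :
    ContinuousOn (fun q => fderiv ℝ (fun r => fderiv ℝ (fun q : ℝ × ℝ × ℝ => w q.1 q.2.1 q.2.2) r e) q e')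
      (Ioi 0 ×ˢ univ) :=
  ((kato_contDiffOn_fderiv_apply hw e).continuousOn_fderiv_of_isOpen kato_isOpen_spacetime le_rfl).clm_apply
    continuousOn_const

/-- The time-derivative slice at `t > 0` is the directional derivative field along `(1,0,0)`. [folklore] -/
theorem kato_deriv_time_eq_fderiv
    (hw : ContDiffOn ℝ 2 (fun q : ℝ × ℝ × ℝ => w q.1 q.2.1 q.2.2) (Ioi 0 ×ˢ univ)) {t : ℝ} (ht : 0 < t) :
    (fun x y => deriv (fun s => w s x y) t) =
      fun x y => fderiv ℝ (fun q : ℝ × ℝ × ℝ => w q.1 q.2.1 q.2.2) (t, x, y) (1, 0, 0) :=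
  funext fun x => funext fun y => (kato_hasDerivAt_time_fderiv hw ht x y).deriv

/-- The time-derivative slice at `t > 0` of a field `C²` on `(0,∞) × ℝ²` is `C¹` in space. [folklore] -/
theorem kato_contDiff_deriv_time_slice
    (hw : ContDiffOn ℝ 2 (fun q : ℝ × ℝ × ℝ => w q.1 q.2.1 q.2.2) (Ioi 0 ×ˢ univ)) {t : ℝ} (ht : 0 < t) :
    ContDiff ℝ 1 (fun q : ℝ × ℝ => deriv (fun s => w s q.1 q.2) t) := by
  have h := (kato_contDiffOn_fderiv_apply hw (1, 0, 0)).comp_contDiff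
    (contDiff_const.prodMk contDiff_id : ContDiff ℝ 1 fun q : ℝ × ℝ => ((t, q) : ℝ × ℝ × ℝ))
    fun q => ⟨ht, mem_univ _⟩
  have hfun : (fun q : ℝ × ℝ => deriv (fun s => w s q.1 q.2) t) =
      (fun q => fderiv ℝ (fun q : ℝ × ℝ × ℝ => w q.1 q.2.1 q.2.2) q (1, 0, 0)) ∘
        fun q : ℝ × ℝ => ((t, q) : ℝ × ℝ × ℝ) :=
    funext fun q => (kato_hasDerivAt_time_fderiv hw ht q.1 q.2).deriv
  rw [hfun]
  exact h

/-- `∂ₓ` of the time-derivative slice is the mixed second derivative `D²w(e₁, e₂)`. [folklore] -/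
theorem kato_dX_deriv_time
    (hw : ContDiffOn ℝ 2 (fun q : ℝ × ℝ × ℝ => w q.1 q.2.1 q.2.2) (Ioi 0 ×ˢ univ)) {t : ℝ} (ht : 0 < t)
    (x y : ℝ) : dX (fun x y => deriv (fun s => w s x y) t) x y =
      fderiv ℝ (fun r => fderiv ℝ (fun q : ℝ × ℝ × ℝ => w q.1 q.2.1 q.2.2) r (1, 0, 0)) (t, x, y) (0, 1, 0) := by
  rw [kato_deriv_time_eq_fderiv hw ht]
  exact (kato_hasDerivAt_x_fderiv2 hw (1, 0, 0) ht x y).deriv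

/-- `∂_y` of the time-derivative slice is the mixed second derivative `D²w(e₁, e₃)`. [folklore] -/
theorem kato_dY_deriv_time
    (hw : ContDiffOn ℝ 2 (fun q : ℝ × ℝ × ℝ => w q.1 q.2.1 q.2.2) (Ioi 0 ×ˢ univ)) {t : ℝ} (ht : 0 < t)
    (x y : ℝ) : dY (fun x y => deriv (fun s => w s x y) t) x y =
      fderiv ℝ (fun r => fderiv ℝ (fun q : ℝ × ℝ × ℝ => w q.1 q.2.1 q.2.2) r (1, 0, 0)) (t, x, y) (0, 0, 1) := by
  rw [kato_deriv_time_eq_fderiv hw ht]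
  exact (kato_hasDerivAt_y_fderiv2 hw (1, 0, 0) ht x y).deriv

/-- Time lines of `∂ₓw`: derivative `D²w(e₂, e₁)` (`t > 0`). [folklore] -/
theorem kato_hasDerivAt_dX_time
    (hw : ContDiffOn ℝ 2 (fun q : ℝ × ℝ × ℝ => w q.1 q.2.1 q.2.2) (Ioi 0 ×ˢ univ)) {t : ℝ} (ht : 0 < t)
    (x y : ℝ) : HasDerivAt (fun s => dX (w s) x y)
      (fderiv ℝ (fun r => fderiv ℝ (fun q : ℝ × ℝ × ℝ => w q.1 q.2.1 q.2.2) r (0, 1, 0)) (t, x, y) (1, 0, 0)) t := by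
  refine (kato_hasDerivAt_time_fderiv2 hw (0, 1, 0) ht x y).congr_of_eventuallyEq ?_
  filter_upwards [Ioi_mem_nhds ht] with s hs
  exact (kato_hasDerivAt_x_fderiv hw hs x y).deriv

/-- Time lines of `∂_yw`: derivative `D²w(e₃, e₁)` (`t > 0`). [folklore] -/
theorem kato_hasDerivAt_dY_time
    (hw : ContDiffOn ℝ 2 (fun q : ℝ × ℝ × ℝ => w q.1 q.2.1 q.2.2) (Ioi 0 ×ˢ univ)) {t : ℝ} (ht : 0 < t)
    (x y : ℝ) : HasDerivAt (fun s => dY (w s) x y)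
      (fderiv ℝ (fun r => fderiv ℝ (fun q : ℝ × ℝ × ℝ => w q.1 q.2.1 q.2.2) r (0, 0, 1)) (t, x, y) (1, 0, 0)) t := by
  refine (kato_hasDerivAt_time_fderiv2 hw (0, 0, 1) ht x y).congr_of_eventuallyEq ?_
  filter_upwards [Ioi_mem_nhds ht] with s hs
  exact (kato_hasDerivAt_y_fderiv hw hs x y).deriv

/-- Time derivatives of an `x`-periodic field are `x`-periodic (`t > 0`). [folklore] -/
theorem kato_deriv_time_periodic {L : ℝ} (hper : ∀ t, 0 < t → ∀ x y, w t (x + L) y = w t x y) {t : ℝ}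
    (ht : 0 < t) (x y : ℝ) : deriv (fun s => w s (x + L) y) t = deriv (fun s => w s x y) t := by
  refine Filter.EventuallyEq.deriv_eq ?_
  filter_upwards [Ioi_mem_nhds ht] with s hs
  exact hper s hs x y

end SpaceTime

/-! ## The time derivative of the vorticity is `∂ₓ(∂ₜv) − ∂_y(∂ₜu)` -/

section VorticityTime

variable {u v : ℝ → ℝ → ℝ → ℝ}

/-- **`∂ₜω = ∂ₓ(∂ₜv) − ∂_y(∂ₜu)`** for `ω(t) = ∂ₓv(t) − ∂_yu(t)` and `u, v` jointly `C²` on `(0,∞) × ℝ²` (`t > 0`):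
the time line of the vorticity is differentiable with derivative the slice `∂ₓb − ∂_ya` of the time-derivative
slices `a = ∂ₜu(t)`, `b = ∂ₜv(t)` (symmetry of second derivatives). [folklore] -/
theorem stub_vorticityUniformBounds_vorticityTime {u v : ℝ → ℝ → ℝ → ℝ}
    (hu : ContDiffOn ℝ 2 (fun q : ℝ × ℝ × ℝ => u q.1 q.2.1 q.2.2) (Ioi 0 ×ˢ univ))
    (hv : ContDiffOn ℝ 2 (fun q : ℝ × ℝ × ℝ => v q.1 q.2.1 q.2.2) (Ioi 0 ×ˢ univ)) {t : ℝ} (ht : 0 < t)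
    (x y : ℝ) : HasDerivAt (fun s => vorticity (u s) (v s) x y)
      (dX (fun x y => deriv (fun s => v s x y) t) x y - dY (fun x y => deriv (fun s => u s x y) t) x y) t := by
  have h := (kato_hasDerivAt_dX_time hv ht x y).sub (kato_hasDerivAt_dY_time hu ht x y)
  rw [kato_fderiv2_symm hv ht x y, kato_fderiv2_symm hu ht x y] at h
  rw [kato_dX_deriv_time hv ht, kato_dY_deriv_time hu ht]
  exact h

/-- Joint continuity on `(0,∞) × ℝ²` of `(t, x, y) ↦ ∂ₓb − ∂_ya` (the time derivative of the vorticity).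
[folklore] -/
theorem kato_continuousOn_vorticity_time
    (hu : ContDiffOn ℝ 2 (fun q : ℝ × ℝ × ℝ => u q.1 q.2.1 q.2.2) (Ioi 0 ×ˢ univ))
    (hv : ContDiffOn ℝ 2 (fun q : ℝ × ℝ × ℝ => v q.1 q.2.1 q.2.2) (Ioi 0 ×ˢ univ)) :
    ContinuousOn (fun q : ℝ × ℝ × ℝ => dX (fun x y => deriv (fun s => v s x y) q.1) q.2.1 q.2.2 -
      dY (fun x y => deriv (fun s => u s x y) q.1) q.2.1 q.2.2) (Ioi 0 ×ˢ univ) := by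
  refine ((kato_continuousOn_fderiv2 hv (1, 0, 0) (0, 1, 0)).sub
    (kato_continuousOn_fderiv2 hu (1, 0, 0) (0, 0, 1))).congr ?_
  rintro ⟨t, x, y⟩ ⟨ht, -⟩
  have ht' : 0 < t := ht
  dsimp only
  rw [Pi.sub_apply, kato_dX_deriv_time hv ht', kato_dY_deriv_time hu ht']

/-- Joint continuity on `(0,∞) × ℝ²` of the vorticity `(t, x, y) ↦ ω(t, x, y)`. [folklore] -/
theorem kato_continuousOn_vorticity_spacetime
    (hu : ContDiffOn ℝ 2 (fun q : ℝ × ℝ × ℝ => u q.1 q.2.1 q.2.2) (Ioi 0 ×ˢ univ))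
    (hv : ContDiffOn ℝ 2 (fun q : ℝ × ℝ × ℝ => v q.1 q.2.1 q.2.2) (Ioi 0 ×ˢ univ)) :
    ContinuousOn (fun q : ℝ × ℝ × ℝ => vorticity (u q.1) (v q.1) q.2.1 q.2.2) (Ioi 0 ×ˢ univ) := by
  refine ((kato_continuousOn_fderiv_apply hv (0, 1, 0)).sub (kato_continuousOn_fderiv_apply hu (0, 0, 1))).congr ?_
  rintro ⟨t, x, y⟩ ⟨ht, -⟩
  have ht' : 0 < t := ht
  dsimp only
  rw [vorticity, Pi.sub_apply, ← (kato_hasDerivAt_x_fderiv hv ht' x y).deriv,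
    ← (kato_hasDerivAt_y_fderiv hu ht' x y).deriv]
  rfl

end VorticityTime

/-! ## The cutoff across the layer -/

section Cutoff

/-- The derivative of Mathlib's `Real.smoothTransition` is bounded (it is continuous and vanishes off `[0, 1]`).
[folklore] -/
theorem kato_smoothTransition_deriv_bound : ∃ Cσ : ℝ, 0 ≤ Cσ ∧ ∀ x, |deriv Real.smoothTransition x| ≤ Cσ := by
  have hc : Continuous (deriv Real.smoothTransition) :=
    (Real.smoothTransition.contDiff (n := 1)).continuous_deriv le_rfl
  obtain ⟨M, hM⟩ := isCompact_Icc.exists_bound_of_continuousOn (s := Icc (0:ℝ) 1) hc.continuousOn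
  refine ⟨max M 0, le_max_right _ _, fun x => ?_⟩
  by_cases hx : x ∈ Icc (0:ℝ) 1
  · exact (Real.norm_eq_abs _ ▸ hM x hx).trans (le_max_left _ _)
  · -- off `[0,1]` the function is locally constant
    have h0 : deriv Real.smoothTransition x = 0 := by
      rw [mem_Icc, not_and_or, not_le, not_le] at hx
      rcases hx with hx | hx
      · have hev : Real.smoothTransition =ᶠ[𝓝 x] fun _ => (0:ℝ) := by
          filter_upwards [Iio_mem_nhds hx] with s hs
          exact Real.smoothTransition.zero_of_nonpos (le_of_lt hs)
        rw [hev.deriv_eq, deriv_const]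
      · have hev : Real.smoothTransition =ᶠ[𝓝 x] fun _ => (1:ℝ) := by
          filter_upwards [Ioi_mem_nhds hx] with s hs
          exact Real.smoothTransition.one_of_one_le (le_of_lt hs)
        rw [hev.deriv_eq, deriv_const]
    rw [h0, abs_zero]; exact le_max_right _ _

variable {R : ℝ}

/-- The cutoff `ψ_R(y) = σ(2 − y/R) σ(2 + y/R)` (`σ` = `Real.smoothTransition`) is `C¹`. [folklore] -/
theorem kato_cutoff_contDiff (R : ℝ) :
    ContDiff ℝ 1 (fun y : ℝ => Real.smoothTransition (2 - y / R) * Real.smoothTransition (2 + y / R)) := by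
  fun_prop

/-- `0 ≤ ψ_R`. [folklore] -/
theorem kato_cutoff_nonneg (R y : ℝ) :
    0 ≤ Real.smoothTransition (2 - y / R) * Real.smoothTransition (2 + y / R) :=
  mul_nonneg (Real.smoothTransition.nonneg _) (Real.smoothTransition.nonneg _)

/-- `ψ_R ≤ 1`. [folklore] -/
theorem kato_cutoff_le_one (R y : ℝ) :
    Real.smoothTransition (2 - y / R) * Real.smoothTransition (2 + y / R) ≤ 1 :=
  mul_le_one₀ (Real.smoothTransition.le_one _) (Real.smoothTransition.nonneg _)
    (Real.smoothTransition.le_one _)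

/-- `|ψ_R| ≤ 1`. [folklore] -/
theorem kato_cutoff_abs_le_one (R y : ℝ) :
    |Real.smoothTransition (2 - y / R) * Real.smoothTransition (2 + y / R)| ≤ 1 := by
  rw [abs_of_nonneg (kato_cutoff_nonneg R y)]; exact kato_cutoff_le_one R y

/-- `ψ_R(y) = 1` for `|y| ≤ R` (`R > 0`). [folklore] -/
theorem kato_cutoff_eq_one (hR : 0 < R) {y : ℝ} (hy : |y| ≤ R) :
    Real.smoothTransition (2 - y / R) * Real.smoothTransition (2 + y / R) = 1 := by
  have h1 : y / R ≤ 1 := by rw [div_le_one hR]; exact (le_abs_self y).trans hy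
  have h2 : -1 ≤ y / R := by rw [le_div_iff₀ hR]; linarith [neg_abs_le y]
  rw [Real.smoothTransition.one_of_one_le (by linarith), Real.smoothTransition.one_of_one_le (by linarith),
    mul_one]

/-- `ψ_R(y) = 0` for `|y| ≥ 2R` (`R > 0`). [folklore] -/
theorem kato_cutoff_eq_zero (hR : 0 < R) {y : ℝ} (hy : 2 * R ≤ |y|) :
    Real.smoothTransition (2 - y / R) * Real.smoothTransition (2 + y / R) = 0 := by
  rcases le_or_gt 0 y with h | h
  · rw [abs_of_nonneg h] at hy
    have : 2 ≤ y / R := by rw [le_div_iff₀ hR]; linarith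
    rw [Real.smoothTransition.zero_of_nonpos (by linarith), zero_mul]
  · rw [abs_of_neg h] at hy
    have : y / R ≤ -2 := by rw [div_le_iff₀ hR]; linarith
    rw [Real.smoothTransition.zero_of_nonpos (show 2 + y / R ≤ 0 by linarith), mul_zero]

/-- `ψ_R′(y) = 0` for `|y| < R` (locally constant `1`). [folklore] -/
theorem kato_cutoff_deriv_eq_zero_of_lt (hR : 0 < R) {y : ℝ} (hy : |y| < R) :
    deriv (fun y : ℝ => Real.smoothTransition (2 - y / R) * Real.smoothTransition (2 + y / R)) y = 0 := by
  have hev : (fun y : ℝ => Real.smoothTransition (2 - y / R) * Real.smoothTransition (2 + y / R)) =ᶠ[𝓝 y]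
      fun _ => (1:ℝ) := by
    filter_upwards [(isOpen_Iio.preimage continuous_abs).mem_nhds (show |y| < R from hy)] with s hs
    exact kato_cutoff_eq_one hR (le_of_lt hs)
  rw [hev.deriv_eq, deriv_const]

/-- `ψ_R′(y) = 0` for `|y| > 2R` (locally constant `0`). [folklore] -/
theorem kato_cutoff_deriv_eq_zero_of_gt (hR : 0 < R) {y : ℝ} (hy : 2 * R < |y|) :
    deriv (fun y : ℝ => Real.smoothTransition (2 - y / R) * Real.smoothTransition (2 + y / R)) y = 0 := by
  have hev : (fun y : ℝ => Real.smoothTransition (2 - y / R) * Real.smoothTransition (2 + y / R)) =ᶠ[𝓝 y]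
      fun _ => (0:ℝ) := by
    filter_upwards [(isOpen_Ioi.preimage continuous_abs).mem_nhds (show 2 * R < |y| from hy)] with s hs
    exact kato_cutoff_eq_zero hR (le_of_lt hs)
  rw [hev.deriv_eq, deriv_const]

/-- `|ψ_R′| ≤ 2C_σ/R` (`R > 0`), `C_σ` a bound for `|σ′|`. [folklore] -/
theorem kato_cutoff_deriv_bound (hR : 0 < R) {Cσ : ℝ} (hCσ : ∀ x, |deriv Real.smoothTransition x| ≤ Cσ)
    (y : ℝ) :
    |deriv (fun y : ℝ => Real.smoothTransition (2 - y / R) * Real.smoothTransition (2 + y / R)) y| ≤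
      2 * Cσ / R := by
  have hσd : ∀ x, HasDerivAt Real.smoothTransition (deriv Real.smoothTransition x) x := fun x =>
    ((Real.smoothTransition.contDiff (n := 1)).differentiable (by simp) x).hasDerivAt
  have h1 : HasDerivAt (fun y : ℝ => 2 - y / R) (-(1 / R)) y := by
    simpa using ((hasDerivAt_id y).div_const R).const_sub 2
  have h2 : HasDerivAt (fun y : ℝ => 2 + y / R) (1 / R) y := by
    simpa using ((hasDerivAt_id y).div_const R).const_add 2
  have hd : HasDerivAt (fun y : ℝ => Real.smoothTransition (2 - y / R) * Real.smoothTransition (2 + y / R))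
      (deriv Real.smoothTransition (2 - y / R) * -(1 / R) * Real.smoothTransition (2 + y / R) +
        Real.smoothTransition (2 - y / R) * (deriv Real.smoothTransition (2 + y / R) * (1 / R))) y :=
    (HasDerivAt.comp (h₂ := Real.smoothTransition) (h := fun y : ℝ => 2 - y / R) y (hσd (2 - y / R)) h1).mul
      (HasDerivAt.comp (h₂ := Real.smoothTransition) (h := fun y : ℝ => 2 + y / R) y (hσd (2 + y / R)) h2)
  rw [hd.deriv]
  have hb1 := hCσ (2 - y / R); have hb2 := hCσ (2 + y / R)
  have hs1 := Real.smoothTransition.nonneg (2 - y / R); have hs2 := Real.smoothTransition.le_one (2 - y / R)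
  have hs3 := Real.smoothTransition.nonneg (2 + y / R); have hs4 := Real.smoothTransition.le_one (2 + y / R)
  have hR' : 0 < 1 / R := by positivity
  have hCσ0 : 0 ≤ Cσ := (abs_nonneg _).trans (hCσ 0)
  have e1 : |deriv Real.smoothTransition (2 - y / R) * -(1 / R) * Real.smoothTransition (2 + y / R)| ≤
      Cσ * (1 / R) * 1 := by
    rw [abs_mul, abs_mul, abs_neg, abs_of_pos hR', abs_of_nonneg hs3]
    exact mul_le_mul (mul_le_mul_of_nonneg_right hb1 hR'.le) hs4 hs3 (by positivity)
  have e2 : |Real.smoothTransition (2 - y / R) * (deriv Real.smoothTransition (2 + y / R) * (1 / R))| ≤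
      1 * (Cσ * (1 / R)) := by
    rw [abs_mul, abs_mul, abs_of_pos hR', abs_of_nonneg hs1]
    exact mul_le_mul hs2 (mul_le_mul_of_nonneg_right hb2 hR'.le) (by positivity) zero_le_one
  calc |deriv Real.smoothTransition (2 - y / R) * -(1 / R) * Real.smoothTransition (2 + y / R) +
        Real.smoothTransition (2 - y / R) * (deriv Real.smoothTransition (2 + y / R) * (1 / R))|
      ≤ |deriv Real.smoothTransition (2 - y / R) * -(1 / R) * Real.smoothTransition (2 + y / R)| +
        |Real.smoothTransition (2 - y / R) * (deriv Real.smoothTransition (2 + y / R) * (1 / R))| :=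
        abs_add_le _ _
    _ ≤ Cσ * (1 / R) * 1 + 1 * (Cσ * (1 / R)) := add_le_add e1 e2
    _ = 2 * Cσ / R := by ring

end Cutoff


end Summit.AnomalousDissipation.AnomalousDissipation.Theorems.StrainedLayerLaw.StrainWorkSumRule

end
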